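import Literature.Computability.AlgebraicComplexity.MR04HessianExactRank
import HarnessLib

/-!
# LMR13 Lemma 3.3.1: the radical of the Hessian quadratic form of `det_n` at a corank-one matrix

[topic Computability/AlgebraicComplexity]

Source. J. M. Landsberg, L. Manivel, N. Ressayre, *Hypersurfaces with degenerate duals and the
geometric complexity theory program*, Comment. Math. Helv. 88 (2013) 469–484, §3.3, **Lemma 3.3.1**
(journal p. 478; arXiv:1004.4802v1 `paper:arxiv-1004.4802 p0006.txt:L100–105`, proof
`p0007.txt:L1–14`), verbatim: "Let `w` be a matrix of rank exactly `n−1`. Then the singular locus of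
the quadratic form `H_{det_n,w}`, `(H_{det_n,w})_{sing}`, is the space of `n × n` matrices `X` such
that: 1) `Im(X) ⊂ Im(w)`, 2) `Ker(X) ⊃ Ker(w)`, 3) `w^*(X) = 0`."  Proof (printed): in bases adapted
to `w = φ_1 ⊗ e_1 + ⋯ + φ_{n−1} ⊗ e_{n−1}`, "`H_{det_n,w}(X) = det(w,…,w,X,X) = Σ_{i=1}^{n−1}
(x_{nn}x_{ii} − x_{ni}x_{in})`. This implies that the singular locus … is defined by the conditions
`x_{ni} = x_{in} = 0` for `1 ≤ i ≤ n`, and `Σ_{i=1}^{n−1} x_{ii} = 0`."  This is the `det`-specific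
input of LMR13 Lemma 3.3.2 / §3.4 (the relations of Lemma 3.4.1 are obtained by substituting the
elements of `(H_{det_n,w})_{sing}` into (Zar)).  Everything here is PROVED; no named fact.

## What is typed (tree vocabulary: `hessianMatrix (detPoly ι k) w : Matrix (ι×ι) (ι×ι) k`,
`HessianRank.lean`; the radical of the form = the kernel of this symmetric matrix, `H *ᵥ X = 0`)

* §K1, at the normal form `w = Λ_{i₀} = diag(1,…,0_{i₀},…,1)` (`lamMatrix`,
  `LandsbergRessayreNormalForm.lean`; the printed `w` with `n ↔ i₀`), building on the entrywise Hessian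
  `hessianMatrix_detPoly_lamMatrix_apply` (`MR04HessianExactRank.lean`):
  `hessianMatrix_detPoly_lamMatrix_mulVec` (`H·X` entry by entry),
  `hessianMatrix_detPoly_lamMatrix_mulVec_eq_zero_iff` — **the printed coordinate statement**:
  `H·X = 0 ↔ X_{i₀ j} = X_{j i₀} = 0 ∀ j ∧ Σ_{j ≠ i₀} X_{jj} = 0` (`|ι| ≥ 2`), and the value of the form
  `dotProduct_hessianMatrix_detPoly_lamMatrix_mulVec`: `Xᵀ H X = 2 Σ_{j≠i₀}(X_{i₀i₀}X_{jj} − X_{i₀j}X_{ji₀})`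
  (the printed "easy computation", with the factor `2` of `Xᵀ·Hess·X = 2·[ε²]det(Λ+εX)`).
* §K2, transport ("by the action of `GL(A) × GL(B)` by left-right multiplication", §3.4): the
  Kronecker matrix `kronSubst P Q` of `X ↦ PXQ`, the substitution identity
  `hessianMatrix_detPoly_transport` (`det P det Q · H_Λ = Lᵀ H_{PΛQ} L`, the identity inside the
  tree's `rank_hessianMatrix_detPoly_le_of_mul_mul`, now exposed), and
  `hessianMatrix_detPoly_mulVec_eq_zero_iff_of_mul_mul`: `PXQ ∈ rad H_{PΛQ} ↔ X ∈ rad H_Λ`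
  (`P, Q` invertible, any field).
* `hessianMatrix_detPoly_mulVec_eq_zero_iff_of_factorisation` — **Lemma 3.3.1 through a rank
  factorisation `w = C · R`** (`|ι| ≥ 2`; columns of `C` and rows of `R` independent, `|ι| − 1` of each):
  `X ∈ rad H_w ↔ ∃ Z, tr Z = 0 ∧ X = C Z R` — the shape §3.4 consumes ("`X = Σ_i (e_i^* + μ_i e_n^*) ⊗
  (Σ_j ζ_i^j c_j)`, where `Σ_i ζ_i^i = 0`", arXiv `p0007.txt:L58–62`); conditions 1), 2) = the
  factorisation through `C` and `R`, condition 3) = `tr Z = 0`.  (For `|ι| = 1` the Lemma fails as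
  worded: `w = 0`, `H = 0`, every `X` is singular.)
* `hessianMatrix_detPoly_mulVec_eq_zero_iff_of_rank` — **Lemma 3.3.1 for every corank-one `Y`**:
  adapted invertible `P, Q` and `i₀` with `Y = P Λ_{i₀} Q` exist (`exists_mul_mul_eq_lamMatrix`), and
  `X ∈ rad H_Y` iff `X₀ = P⁻¹XQ⁻¹` has zero `i₀`-th row and column (⟺ 1) `Im X ⊆ Im Y` and
  2) `Ker X ⊇ Ker Y`) and `Σ_{j≠i₀}(X₀)_{jj} = 0`.

## Note on condition 3) as printed

The print identifies `Σ_{i<n} x_{ii} = 0` with "`w^*(X) = 0`", `w^*` being the image of `w` under the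
involution `E ⊗ E^* → E^* ⊗ E` (so `w^*(X) = tr(w X)`).  This identification holds in the proof's
coordinates when the completed bases `(e_i)`, `(φ_i)` are DUAL (then `w` is a projection), but it is
not the invariant condition for a general corank-one `w`: for `n = 3`, `w = diag(1,2,0)`, expanding
`det(w + εX)` gives the quadratic part `2(x₁₁x₃₃ − x₁₃x₃₁) + (x₂₂x₃₃ − x₂₃x₃₂)`, whose radical inside
`{x₃ᵢ = xᵢ₃ = 0}` is `2x₁₁ + x₂₂ = 0`, whereas `tr(wX) = x₁₁ + 2x₂₂`.  The invariant form of 3) is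
`tr(w̄⁻¹ X̄) = 0` for the isomorphism `w̄ : E/Ker w ⥲ Im w` induced by `w` and the map `X̄` induced by
`X` (given 1), 2)), which is what the typed statements say (`Σ_{j≠i₀}(P⁻¹XQ⁻¹)_{jj} = 0`), and it is
the coordinate form — not "`w^*(X) = 0`" — that §3.4 uses (arXiv `p0007.txt:L58–62`:
"`X = Σ_i (e_i^* + μ_i e_n^*) ⊗ (Σ_j ζ_i^j c_j)`, where `Σ_i ζ_i^i = 0`").  Recorded for the cell's print
ledger; no statement of the tree depends on the printed wording.

## References

* [LandsbergManivelRessayre2013] Landsberg–Manivel–Ressayre, Comment. Math. Helv. 88 (2013), §3.3,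
  Lemma 3.3.1 and its proof (p. 478), Lemma 3.3.2, §3.4 (pp. 478–480); arXiv:1004.4802v1 pp. 6–7.
* [LandsbergGCT2017] J. M. Landsberg, *Geometry and Complexity Theory*, CUP 2017, §6.4.5 and
  Exercise 6.4.5.2 (the substitution `X ↦ PXQ`).
-/

noncomputable section

open MvPolynomial Matrix

namespace Literature.Computability.AlgebraicComplexity

universe u v

/-! ### §K1 The radical at the normal form `Λ_{i₀}` -/

section AtLambda

variable {k : Type u} [CommRing k] {ι : Type v} [Fintype ι] [DecidableEq ι]

/-- **`Hess DET (Λ_{i₀}) · X`, entry by entry.** With `S = Σ_{j ≠ i₀} X_{jj}`: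
`(H X)_{(c, i₀)} = S` if `c = i₀` and `−X_{i₀ c}` otherwise; for `d ≠ i₀`,
`(H X)_{(c,d)} = [c = d] X_{i₀ i₀} − [c = i₀] X_{d i₀}` — the gradient of the quadratic part
`Σ_{j ≠ i₀}(X_{i₀ i₀} X_{jj} − X_{i₀ j} X_{j i₀})` of `det(Λ_{i₀} + X)`.
[cite: LandsbergManivelRessayre2013, Lemma 3.3.1 (proof, p. 478)] -/
theorem hessianMatrix_detPoly_lamMatrix_mulVec (i₀ : ι) (X : ι × ι → k) (c d : ι) :
    (hessianMatrix (detPoly ι k) (fun p => lamMatrix k i₀ p.1 p.2) *ᵥ X) (c, d) =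
      if d = i₀ then (if c = i₀ then ∑ j ∈ Finset.univ.erase i₀, X (j, j) else -X (i₀, c))
      else (if c = d then X (i₀, i₀) else 0) - (if c = i₀ then X (d, i₀) else 0) := by
  have hA : ∀ b, ∑ a, (if c = d ∧ a = b then (1 : k) else 0) * X (a, b) =
      if c = d then X (b, b) else 0 := by
    intro b
    by_cases hc : c = d
    · simp only [hc, true_and, if_true]
      rw [Finset.sum_eq_single b (fun a _ hab => by rw [if_neg hab, zero_mul])
        (fun hb => absurd (Finset.mem_univ b) hb), if_pos rfl, one_mul]
    · simp [hc]
  have hB : ∀ b, ∑ a, (if c = b ∧ a = d then (1 : k) else 0) * X (a, b) =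
      if c = b then X (d, b) else 0 := by
    intro b
    by_cases hc : c = b
    · simp only [hc, true_and, if_true]
      rw [Finset.sum_eq_single d (fun a _ had => by rw [if_neg had, zero_mul])
        (fun hd => absurd (Finset.mem_univ d) hd), if_pos rfl, one_mul]
    · simp [hc]
  have h1 : ∀ b, ∑ a, hessianMatrix (detPoly ι k) (fun p => lamMatrix k i₀ p.1 p.2) (c, d) (a, b) *
      X (a, b) = if d ≠ b ∧ (d = i₀ ∨ b = i₀) then
        ((if c = d then X (b, b) else 0) - (if c = b then X (d, b) else 0)) else 0 := by
    intro b
    simp_rw [hessianMatrix_detPoly_lamMatrix_apply]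
    by_cases h : d ≠ b ∧ (d = i₀ ∨ b = i₀)
    · simp only [if_pos h]
      simp_rw [sub_mul]
      rw [Finset.sum_sub_distrib, hA, hB]
    · simp only [if_neg h, zero_mul, Finset.sum_const_zero]
  rw [Matrix.mulVec, dotProduct, Fintype.sum_prod_type, Finset.sum_comm]
  simp_rw [h1]
  by_cases hd : d = i₀
  · subst hd
    simp only [true_or, and_true, if_true]
    by_cases hc : c = d
    · subst hc
      rw [if_pos rfl, ← Finset.sum_filter, Finset.filter_ne]
      refine Finset.sum_congr rfl fun b hb => ?_
      rw [Finset.mem_erase] at hb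
      rw [if_pos rfl, if_neg (Ne.symm hb.1), sub_zero]
    · rw [if_neg hc]
      simp only [hc, if_false, zero_sub]
      rw [Finset.sum_eq_single c (fun b _ hbc => by rw [if_neg (Ne.symm hbc), neg_zero, ite_self])
        (fun h => absurd (Finset.mem_univ c) h), if_pos rfl, if_pos (Ne.symm hc)]
  · simp only [hd, false_or, if_false]
    rw [Finset.sum_eq_single i₀ (fun b _ hb => by rw [if_neg (fun h => hb h.2)])
      (fun h => absurd (Finset.mem_univ i₀) h), if_pos ⟨hd, rfl⟩]

/-- **LMR13 Lemma 3.3.1 at the normal form** (arXiv `p0007.txt:L11–13`: "the singular locus of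
the quadratic form `H_{det_n,w}` is defined by the conditions `x_{ni} = x_{in} = 0` for `1 ≤ i ≤ n`, and
`Σ_{i=1}^{n−1} x_{ii} = 0`"): for `|ι| ≥ 2`, a matrix `X` is in the radical (kernel) of the Hessian
form of `DET_ι` at `Λ_{i₀} = diag(1, …, 0_{i₀}, …, 1)` iff its `i₀`-th row and column vanish and
`Σ_{j ≠ i₀} X_{jj} = 0`. (For `|ι| = 1`, `DET = X` has zero Hessian and the statement fails.)
[cite: LandsbergManivelRessayre2013, Lemma 3.3.1 (p. 478)] -/
theorem hessianMatrix_detPoly_lamMatrix_mulVec_eq_zero_iff (i₀ : ι) (h2 : 2 ≤ Fintype.card ι)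
    (X : ι × ι → k) :
    hessianMatrix (detPoly ι k) (fun p => lamMatrix k i₀ p.1 p.2) *ᵥ X = 0 ↔
      (∀ j, X (i₀, j) = 0) ∧ (∀ j, X (j, i₀) = 0) ∧ ∑ j ∈ Finset.univ.erase i₀, X (j, j) = 0 := by
  constructor
  · intro h
    have e : ∀ c d, (if d = i₀ then (if c = i₀ then ∑ j ∈ Finset.univ.erase i₀, X (j, j) else -X (i₀, c))
        else (if c = d then X (i₀, i₀) else 0) - (if c = i₀ then X (d, i₀) else 0)) = 0 := by
      intro c d
      rw [← hessianMatrix_detPoly_lamMatrix_mulVec, h, Pi.zero_apply]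
    obtain ⟨j₁, hj₁⟩ := Fintype.exists_ne_of_one_lt_card (by omega) i₀
    have hrow : ∀ j, j ≠ i₀ → X (i₀, j) = 0 := fun j hj => by
      have h1 := e j i₀
      rwa [if_pos rfl, if_neg hj, neg_eq_zero] at h1
    have h00 : X (i₀, i₀) = 0 := by
      have h1 := e j₁ j₁
      rwa [if_neg hj₁, if_pos rfl, if_neg hj₁, sub_zero] at h1
    have hcol : ∀ j, j ≠ i₀ → X (j, i₀) = 0 := fun j hj => by
      have h1 := e i₀ j
      rwa [if_neg hj, if_neg (Ne.symm hj), if_pos rfl, zero_sub, neg_eq_zero] at h1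
    have hsum := e i₀ i₀
    rw [if_pos rfl, if_pos rfl] at hsum
    refine ⟨fun j => ?_, fun j => ?_, hsum⟩
    · by_cases hj : j = i₀
      · rw [hj]; exact h00
      · exact hrow j hj
    · by_cases hj : j = i₀
      · rw [hj]; exact h00
      · exact hcol j hj
  · rintro ⟨hr, hc, hs⟩
    funext p
    obtain ⟨c, d⟩ := p
    rw [hessianMatrix_detPoly_lamMatrix_mulVec, Pi.zero_apply]
    split_ifs <;> simp [hr, hc, hs]

/-- **The Hessian quadratic form of `DET` at `Λ_{i₀}`** ("An easy computation yields
`H_{det_n,w}(X) = det(w,…,w,X,X) = Σ_{i=1}^{n−1}(x_{nn}x_{ii} − x_{ni}x_{in})`", arXiv `p0007.txt:L7–9`;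
here with the factor `2` of `Xᵀ · Hess · X = 2 · [ε²] det(Λ + εX)`).
[cite: LandsbergManivelRessayre2013, Lemma 3.3.1 (proof, p. 478)] -/
theorem dotProduct_hessianMatrix_detPoly_lamMatrix_mulVec (i₀ : ι) (X : ι × ι → k) :
    X ⬝ᵥ (hessianMatrix (detPoly ι k) (fun p => lamMatrix k i₀ p.1 p.2) *ᵥ X) =
      2 * ∑ j ∈ Finset.univ.erase i₀, (X (i₀, i₀) * X (j, j) - X (i₀, j) * X (j, i₀)) := by
  rw [dotProduct, Fintype.sum_prod_type]
  simp_rw [hessianMatrix_detPoly_lamMatrix_mulVec]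
  -- split the inner sum over `d` at `d = i₀`
  have hsplit : ∀ c, ∑ d, X (c, d) * (if d = i₀ then
      (if c = i₀ then ∑ j ∈ Finset.univ.erase i₀, X (j, j) else -X (i₀, c))
      else (if c = d then X (i₀, i₀) else 0) - (if c = i₀ then X (d, i₀) else 0)) =
      X (c, i₀) * (if c = i₀ then ∑ j ∈ Finset.univ.erase i₀, X (j, j) else -X (i₀, c)) +
        ∑ d ∈ Finset.univ.erase i₀,
          X (c, d) * ((if c = d then X (i₀, i₀) else 0) - (if c = i₀ then X (d, i₀) else 0)) := by
    intro c
    rw [← Finset.add_sum_erase _ _ (Finset.mem_univ i₀), if_pos rfl]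
    congr 1
    refine Finset.sum_congr rfl fun d hd => ?_
    rw [Finset.mem_erase] at hd
    rw [if_neg hd.1]
  simp_rw [hsplit]
  rw [Finset.sum_add_distrib, ← Finset.add_sum_erase _ _ (Finset.mem_univ i₀), if_pos rfl]
  have hA : ∑ c ∈ Finset.univ.erase i₀, X (c, i₀) *
      (if c = i₀ then ∑ j ∈ Finset.univ.erase i₀, X (j, j) else -X (i₀, c)) =
      -∑ j ∈ Finset.univ.erase i₀, X (i₀, j) * X (j, i₀) := by
    rw [← Finset.sum_neg_distrib]
    refine Finset.sum_congr rfl fun c hc => ?_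
    rw [Finset.mem_erase] at hc
    rw [if_neg hc.1]
    ring
  have hB : ∑ c, ∑ d ∈ Finset.univ.erase i₀,
      X (c, d) * ((if c = d then X (i₀, i₀) else 0) - (if c = i₀ then X (d, i₀) else 0)) =
      ∑ j ∈ Finset.univ.erase i₀, (X (i₀, i₀) * X (j, j) - X (i₀, j) * X (j, i₀)) := by
    rw [Finset.sum_comm]
    refine Finset.sum_congr rfl fun d hd => ?_
    rw [Finset.mem_erase] at hd
    rw [← Finset.add_sum_erase _ _ (Finset.mem_univ i₀), if_neg (Ne.symm hd.1), if_pos rfl, zero_sub,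
      ← Finset.add_sum_erase _ _ (Finset.mem_erase.mpr ⟨hd.1, Finset.mem_univ d⟩), if_pos rfl,
      if_neg hd.1, sub_zero]
    rw [Finset.sum_eq_zero fun c hc => ?_]
    · ring
    · rw [Finset.mem_erase, Finset.mem_erase] at hc
      rw [if_neg hc.1, if_neg hc.2.1, sub_zero, mul_zero]
  rw [hA, hB, Finset.mul_sum, Finset.mul_sum]
  rw [← Finset.sum_neg_distrib, ← Finset.sum_add_distrib, ← Finset.sum_add_distrib]
  refine Finset.sum_congr rfl fun j _ => ?_
  ring

end AtLambda

/-! ### §K2 Transport of the radical along `X ↦ P X Q` -/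

section Transport

variable {k : Type u} [Field k] {ι : Type v} [Fintype ι] [DecidableEq ι]

/-- The Kronecker matrix of the substitution `X ↦ P X Q` on `ι × ι` coordinates:
`L_{(i,j),(a,b)} = P_{i a} Q_{b j}`. [cite: LandsbergGCT2017, Exercise 6.4.5.2] -/
def kronSubst (P Q : Matrix ι ι k) : Matrix (ι × ι) (ι × ι) k :=
  Matrix.of fun t v => P t.1 v.1 * Q v.2 t.2

omit [DecidableEq ι] in
/-- `L_{P,Q}` acts on vectorised matrices as `X ↦ P X Q`. [cite: LandsbergGCT2017, Exercise 6.4.5.2] -/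
theorem kronSubst_mulVec (P Q X : Matrix ι ι k) :
    kronSubst P Q *ᵥ (fun p : ι × ι => X p.1 p.2) = fun p => (P * X * Q) p.1 p.2 := by
  funext t
  simp only [Matrix.mulVec, dotProduct, kronSubst, Matrix.of_apply, Matrix.mul_apply, Finset.sum_mul]
  rw [Fintype.sum_prod_type, Finset.sum_comm]
  refine Finset.sum_congr rfl fun b _ => Finset.sum_congr rfl fun a _ => ?_
  ring

omit [DecidableEq ι] in
/-- `L_{P,Q} L_{P',Q'} = L_{PP', Q'Q}`. [cite: LandsbergGCT2017, Exercise 6.4.5.2] -/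
theorem kronSubst_mul_kronSubst (P Q P' Q' : Matrix ι ι k) :
    kronSubst P Q * kronSubst P' Q' = kronSubst (P * P') (Q' * Q) := by
  ext t s
  simp only [Matrix.mul_apply, kronSubst, Matrix.of_apply]
  rw [Fintype.sum_prod_type, Finset.sum_mul_sum]
  refine Finset.sum_congr rfl fun a _ => Finset.sum_congr rfl fun b _ => ?_
  ring

omit [Fintype ι] in
/-- `L_{1,1} = 1`. [cite: LandsbergGCT2017, Exercise 6.4.5.2] -/
theorem kronSubst_one_one : kronSubst (1 : Matrix ι ι k) 1 = 1 := by
  classical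
  ext t s
  simp only [kronSubst, Matrix.of_apply, Matrix.one_apply, Prod.ext_iff]
  by_cases h1 : t.1 = s.1 <;> by_cases h2 : t.2 = s.2 <;> simp [h1, h2, eq_comm]

/-- `L_{P,Q}` is invertible for invertible `P, Q`. [cite: LandsbergGCT2017, Exercise 6.4.5.2] -/
theorem isUnit_kronSubst {P Q : Matrix ι ι k} (hP : IsUnit P) (hQ : IsUnit Q) :
    IsUnit (kronSubst P Q) := by
  have hPd : IsUnit P.det := (Matrix.isUnit_iff_isUnit_det P).mp hP
  have hQd : IsUnit Q.det := (Matrix.isUnit_iff_isUnit_det Q).mp hQ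
  have h : kronSubst P Q * kronSubst P⁻¹ Q⁻¹ = 1 := by
    rw [kronSubst_mul_kronSubst, Matrix.mul_nonsing_inv P hPd, Matrix.nonsing_inv_mul Q hQd,
      kronSubst_one_one]
  exact (Matrix.isUnit_iff_isUnit_det _).mpr (Matrix.isUnit_det_of_right_inverse h)

/-- **Transport of the Hessian of `det` along `X ↦ P X Q`** (the substitution principle,
`DET ∘ (X ↦ PXQ) = det P · det Q · DET` and the affine chain rule `hessianMatrix_aeval_C_add_linear`):
`(det P · det Q) · Hess DET (Λ) = L_{P,Q}ᵀ · Hess DET (P Λ Q) · L_{P,Q}` — the identity behind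
`rank_hessianMatrix_detPoly_le_of_mul_mul`. [cite: LandsbergGCT2017, Exercise 6.4.5.2] -/
theorem hessianMatrix_detPoly_transport (P Λ Q : Matrix ι ι k) :
    (P.det * Q.det) • hessianMatrix (detPoly ι k) (fun p => Λ p.1 p.2) =
      (kronSubst P Q)ᵀ * hessianMatrix (detPoly ι k) (fun p => (P * Λ * Q) p.1 p.2) * kronSubst P Q := by
  set L : Matrix (ι × ι) (ι × ι) k := kronSubst P Q with hL
  have hchain := hessianMatrix_aeval_C_add_linear (fun _ : ι × ι => (0 : k)) L (detPoly ι k)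
    (fun p => Λ p.1 p.2)
  have hsub : aeval (fun t : ι × ι => C ((fun _ : ι × ι => (0 : k)) t) + ∑ v, C (L t v) * X v)
      (detPoly ι k) = C (P.det * Q.det) * detPoly ι k := by
    have hmat : (aeval fun t : ι × ι => C ((fun _ : ι × ι => (0 : k)) t) + ∑ v, C (L t v) * X v).mapMatrix
        (mvPolynomialX ι ι k) = P.map C * mvPolynomialX ι ι k * Q.map C := by
      refine Matrix.ext fun i j => ?_
      simp only [AlgHom.mapMatrix_apply, Matrix.map_apply, mvPolynomialX_apply, aeval_X, map_zero,
        zero_add, Matrix.mul_apply, hL, kronSubst, Matrix.of_apply, Finset.sum_mul]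
      rw [Fintype.sum_prod_type, Finset.sum_comm]
      refine Finset.sum_congr rfl fun b _ => Finset.sum_congr rfl fun a _ => ?_
      rw [map_mul]
      ring
    have hPd : (P.map (C : k →+* MvPolynomial (ι × ι) k)).det = C P.det := by
      rw [← RingHom.mapMatrix_apply, ← RingHom.map_det]
    have hQd : (Q.map (C : k →+* MvPolynomial (ι × ι) k)).det = C Q.det := by
      rw [← RingHom.mapMatrix_apply, ← RingHom.map_det]
    rw [detPoly, AlgHom.map_det, hmat, Matrix.det_mul, Matrix.det_mul, hPd, hQd, map_mul]
    ring
  have hpt : (fun t : ι × ι => (fun _ : ι × ι => (0 : k)) t + ∑ v, L t v * (fun p : ι × ι => Λ p.1 p.2) v)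
      = fun p => (P * Λ * Q) p.1 p.2 := by
    funext t
    simp only [zero_add, hL, kronSubst, Matrix.of_apply, Matrix.mul_apply, Finset.sum_mul]
    rw [Fintype.sum_prod_type, Finset.sum_comm]
    refine Finset.sum_congr rfl fun b _ => Finset.sum_congr rfl fun a _ => ?_
    ring
  rw [hsub, hpt, C_mul', hessianMatrix_smul] at hchain
  exact hchain

/-- **The radical transports along `X ↦ P X Q`** ("by the action of `GL(A) × GL(B)` by left-right
multiplication", LMR13 §3.4; the `(A,B)`-equivariance behind the basis-free form of Lemma 3.3.1): for
invertible `P, Q`, `P X Q` is in the radical of `Hess DET (P Λ Q)` iff `X` is in the radical of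
`Hess DET (Λ)`. [cite: LandsbergManivelRessayre2013, Lemma 3.3.1 (p. 478); LandsbergGCT2017, Exercise 6.4.5.2] -/
theorem hessianMatrix_detPoly_mulVec_eq_zero_iff_of_mul_mul {P Q : Matrix ι ι k} (hP : IsUnit P)
    (hQ : IsUnit Q) (Λ X : Matrix ι ι k) :
    hessianMatrix (detPoly ι k) (fun p => (P * Λ * Q) p.1 p.2) *ᵥ (fun p => (P * X * Q) p.1 p.2) = 0 ↔
      hessianMatrix (detPoly ι k) (fun p => Λ p.1 p.2) *ᵥ (fun p => X p.1 p.2) = 0 := by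
  have hL : IsUnit (kronSubst P Q) := isUnit_kronSubst hP hQ
  have hLT : IsUnit (kronSubst P Q)ᵀ := (Matrix.isUnit_iff_isUnit_det _).mpr
    (Matrix.isUnit_det_transpose _ ((Matrix.isUnit_iff_isUnit_det _).mp hL))
  have hc : IsUnit (P.det * Q.det) :=
    ((Matrix.isUnit_iff_isUnit_det P).mp hP).mul ((Matrix.isUnit_iff_isUnit_det Q).mp hQ)
  have key : (kronSubst P Q)ᵀ *ᵥ (hessianMatrix (detPoly ι k) (fun p => (P * Λ * Q) p.1 p.2) *ᵥ
      (kronSubst P Q *ᵥ fun p : ι × ι => X p.1 p.2)) =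
      (P.det * Q.det) • (hessianMatrix (detPoly ι k) (fun p => Λ p.1 p.2) *ᵥ fun p => X p.1 p.2) := by
    rw [Matrix.mulVec_mulVec, Matrix.mulVec_mulVec, ← hessianMatrix_detPoly_transport,
      Matrix.smul_mulVec]
  rw [← kronSubst_mulVec P Q X]
  constructor
  · intro h
    rw [h, Matrix.mulVec_zero] at key
    exact (hc.smul_eq_zero.mp key.symm)
  · intro h
    rw [h, smul_zero] at key
    exact Matrix.mulVec_injective_iff_isUnit.mpr hLT (key.trans (Matrix.mulVec_zero _).symm)

/-- **LMR13 Lemma 3.3.1, basis-free (every corank-one matrix).** For `|ι| ≥ 2` and `Y` of rank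
`|ι| − 1` there are invertible `P, Q` and `i₀` with `Y = P Λ_{i₀} Q` (adapted bases: the columns of
`P` and the rows of `Q`; `Im Y` = the span of the columns `≠ i₀` of `P`, `Ker Y` = the vectors killed
by the rows `≠ i₀` of `Q`), and then `X` is in the radical of `Hess DET (Y)` iff `X₀ = P⁻¹ X Q⁻¹` has
vanishing `i₀`-th row and column (i.e. `Im X ⊆ Im Y`, `Ker X ⊇ Ker Y`) and `Σ_{j ≠ i₀} (X₀)_{jj} = 0`.
NOTE on the print: Lemma 3.3.1 (3) words the last condition as "`w^*(X) = 0`" with `w^*` the image of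
`w` under the involution `E ⊗ E^* → E^* ⊗ E`, i.e. `tr(w X) = 0`; that agrees with `Σ_{j≠i₀}(X₀)_{jj} = 0`
in the proof's coordinates when the completed bases are dual (`P Q = 1`), but not for a general
corank-one `w` (`n = 3`, `w = diag(1,2,0)`: the radical has `2x₁₁ + x₂₂ = 0`, `tr(wX) = x₁₁ + 2x₂₂`);
what §3.4 uses (arXiv `p0007.txt:L58–62`) is the coordinate form typed here.
[cite: LandsbergManivelRessayre2013, Lemma 3.3.1 (p. 478)] -/
theorem hessianMatrix_detPoly_mulVec_eq_zero_iff_of_rank (h2 : 2 ≤ Fintype.card ι) (Y : Matrix ι ι k)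
    (hY : Y.rank = Fintype.card ι - 1) :
    ∃ (P Q : Matrix ι ι k) (i₀ : ι), IsUnit P ∧ IsUnit Q ∧ Y = P * lamMatrix k i₀ * Q ∧
      ∀ X : Matrix ι ι k,
        hessianMatrix (detPoly ι k) (fun p => Y p.1 p.2) *ᵥ (fun p => X p.1 p.2) = 0 ↔
          (∀ j, (P⁻¹ * X * Q⁻¹) i₀ j = 0) ∧ (∀ j, (P⁻¹ * X * Q⁻¹) j i₀ = 0) ∧
            ∑ j ∈ Finset.univ.erase i₀, (P⁻¹ * X * Q⁻¹) j j = 0 := by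
  obtain ⟨V, U, i₀, hV, hU, hVYU⟩ := exists_mul_mul_eq_lamMatrix Y hY (by omega)
  have hVd : IsUnit V.det := (Matrix.isUnit_iff_isUnit_det V).mp hV
  have hUd : IsUnit U.det := (Matrix.isUnit_iff_isUnit_det U).mp hU
  have hY' : Y = V⁻¹ * lamMatrix k i₀ * U⁻¹ := by
    calc Y = V⁻¹ * (V * Y * U) * U⁻¹ := by
          rw [show V⁻¹ * (V * Y * U) * U⁻¹ = V⁻¹ * V * Y * (U * U⁻¹) by simp only [Matrix.mul_assoc],
            Matrix.nonsing_inv_mul V hVd, Matrix.mul_nonsing_inv U hUd, Matrix.one_mul, Matrix.mul_one]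
      _ = V⁻¹ * lamMatrix k i₀ * U⁻¹ := by rw [hVYU]
  have hVi : IsUnit V⁻¹ := Matrix.isUnit_nonsing_inv_iff.mpr hV
  have hUi : IsUnit U⁻¹ := Matrix.isUnit_nonsing_inv_iff.mpr hU
  refine ⟨V⁻¹, U⁻¹, i₀, hVi, hUi, hY', fun X => ?_⟩
  rw [Matrix.nonsing_inv_nonsing_inv V hVd, Matrix.nonsing_inv_nonsing_inv U hUd]
  have hX : X = V⁻¹ * (V * X * U) * U⁻¹ := by
    rw [show V⁻¹ * (V * X * U) * U⁻¹ = V⁻¹ * V * X * (U * U⁻¹) by simp only [Matrix.mul_assoc],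
      Matrix.nonsing_inv_mul V hVd, Matrix.mul_nonsing_inv U hUd, Matrix.one_mul, Matrix.mul_one]
  rw [hY', ← hessianMatrix_detPoly_lamMatrix_mulVec_eq_zero_iff i₀ h2 (fun p => (V * X * U) p.1 p.2),
    ← hessianMatrix_detPoly_mulVec_eq_zero_iff_of_mul_mul hVi hUi (lamMatrix k i₀) (V * X * U), ← hX]

end Transport

/-! ### §K3 The radical through a rank factorisation `w = C · R` (the form used in §3.4) -/

section Factorisation

variable {k : Type u} [Field k] {ι : Type v} [Fintype ι] [DecidableEq ι]

universe w

omit [DecidableEq ι] in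
/-- A linearly independent family of `|ι| − 1` vectors of `k^ι` misses some vector of `k^ι`.
[folklore] -/
private theorem exists_notMem_span_of_card {m : Type w} [Fintype m]
    (hm : Fintype.card m + 1 = Fintype.card ι) {f : m → ι → k} (hf : LinearIndependent k f) :
    ∃ v : ι → k, v ∉ Submodule.span k (Set.range f) := by
  by_contra! hall
  have htop : ⊤ ≤ Submodule.span k (Set.range f) := fun v _ => hall v
  let b : Module.Basis m k (ι → k) := Module.Basis.mk hf htop
  have h1 := Module.finrank_eq_card_basis b
  rw [Module.finrank_fintype_fun_eq_card] at h1
  omega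

/-- Sums over `ι` of a function vanishing at `i₀`, re-indexed along `e : m ≃ {j // j ≠ i₀}`. [folklore] -/
private theorem sum_eq_sum_equiv_ne {M : Type*} [AddCommMonoid M] {m : Type w} [Fintype m] (i₀ : ι)
    (e : m ≃ {j : ι // j ≠ i₀}) (f : ι → M) (hf : f i₀ = 0) : ∑ j, f j = ∑ a, f (e a) := by
  rw [← Finset.add_sum_erase _ _ (Finset.mem_univ i₀), hf, zero_add,
    Finset.sum_subtype (Finset.univ.erase i₀) (p := fun j => j ≠ i₀) (fun j => by simp) f]
  exact (Fintype.sum_equiv e (fun a => f (e a)) (fun j => f j) fun _ => rfl).symm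

/-- **LMR13 Lemma 3.3.1 through a rank factorisation** — the shape in which §3.4 consumes it
(arXiv `p0007.txt:L55–62`: "`w = Σ_{i=1}^{n−1}(e_i^* + μ_i e_n^*) ⊗ c_i`. By Lemma (ker),
`(H_{det_n,w})_{sing}` can then be described as the set of all
`X = Σ_{i=1}^{n−1}(e_i^* + μ_i e_n^*) ⊗ (Σ_{j=1}^{n−1} ζ_i^j c_j)`, where `Σ_{i=1}^{n−1} ζ_i^i = 0`"):
if `w = C · R` with the `|ι| − 1` columns of `C` independent and the `|ι| − 1` rows of `R` independent
(so `w` has corank one, `Im w = Im C`, `Ker w = Ker R`), then `X` is in the radical of `Hess DET (w)`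
iff `X = C Z R` with `tr Z = 0` — conditions 1), 2) of the Lemma are the factorisation through `C` and
`R`, condition 3) is `tr Z = 0`. [cite: LandsbergManivelRessayre2013, Lemma 3.3.1 (p. 478) and §3.4 (p. 479)] -/
theorem hessianMatrix_detPoly_mulVec_eq_zero_iff_of_factorisation (h2 : 2 ≤ Fintype.card ι)
    {m : Type w} [Fintype m] [DecidableEq m] (hm : Fintype.card m + 1 = Fintype.card ι)
    {C : Matrix ι m k} {R : Matrix m ι k} (hC : LinearIndependent k C.col)
    (hR : LinearIndependent k R.row) (X : Matrix ι ι k) :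
    hessianMatrix (detPoly ι k) (fun p => (C * R) p.1 p.2) *ᵥ (fun p => X p.1 p.2) = 0 ↔
      ∃ Z : Matrix m m k, Z.trace = 0 ∧ X = C * Z * R := by
  classical
  have hι : 0 < Fintype.card ι := by omega
  obtain ⟨i₀⟩ := Fintype.card_pos_iff.mp hι
  -- `e : m ≃ {j ≠ i₀}`
  have hcard : Fintype.card m = Fintype.card {j : ι // j ≠ i₀} := by
    have h1 : Fintype.card (Option {j : ι // j ≠ i₀}) = Fintype.card ι :=
      Fintype.card_congr (Equiv.optionSubtypeNe i₀)
    rw [Fintype.card_option] at h1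
    omega
  let e : m ≃ {j : ι // j ≠ i₀} := Fintype.equivOfCardEq hcard
  have he : ∀ a, ((e a : ι) = i₀) = False := fun a => by simpa using (e a).2
  -- complete the columns of `C` / rows of `R` to invertible `P` / `Q`
  obtain ⟨v, hv⟩ := exists_notMem_span_of_card hm hC
  obtain ⟨u, hu⟩ := exists_notMem_span_of_card hm hR
  let P : Matrix ι ι k := Matrix.of fun s j => if h : j = i₀ then v s else C s (e.symm ⟨j, h⟩)
  let Q : Matrix ι ι k := Matrix.of fun j t => if h : j = i₀ then u t else R (e.symm ⟨j, h⟩) t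
  have hPe : ∀ s a, P s (e a) = C s a := fun s a => by
    simp only [P, Matrix.of_apply, he, dif_neg, not_false_eq_true, Subtype.coe_eta,
      Equiv.symm_apply_apply]
  have hQe : ∀ a t, Q (e a) t = R a t := fun a t => by
    simp only [Q, Matrix.of_apply, he, dif_neg, not_false_eq_true, Subtype.coe_eta,
      Equiv.symm_apply_apply]
  have hP0 : ∀ s, P s i₀ = v s := fun s => by simp [P]
  have hQ0 : ∀ t, Q i₀ t = u t := fun t => by simp [Q]
  -- invertibility through the completed bases
  let ε : Option m ≃ ι := (Equiv.optionCongr e).trans (Equiv.optionSubtypeNe i₀)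
  have hPu : IsUnit P := by
    refine Matrix.linearIndependent_cols_iff_isUnit.mp ((linearIndependent_equiv ε).mp ?_)
    have hfam : P.col ∘ ⇑ε = fun o : Option m => o.elim v C.col := by
      funext o
      cases o with
      | none => funext s; simp [ε, Matrix.col_apply, hP0]
      | some a => funext s; simp [ε, Matrix.col_apply, hPe]
    rw [hfam, linearIndependent_option]
    exact ⟨hC, hv⟩
  have hQu : IsUnit Q := by
    refine Matrix.linearIndependent_rows_iff_isUnit.mp ((linearIndependent_equiv ε).mp ?_)
    have hfam : Q.row ∘ ⇑ε = fun o : Option m => o.elim u R.row := by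
      funext o
      cases o with
      | none => funext t; simp [ε, Matrix.row_apply, hQ0]
      | some a => funext t; simp [ε, Matrix.row_apply, hQe]
    rw [hfam, linearIndependent_option]
    exact ⟨hR, hu⟩
  have hPd : IsUnit P.det := (Matrix.isUnit_iff_isUnit_det P).mp hPu
  have hQd : IsUnit Q.det := (Matrix.isUnit_iff_isUnit_det Q).mp hQu
  -- `P Λ Q = C R`, and `P X₀ Q = C Z R` for `X₀` supported off the `i₀`-th row and column
  have hmul : ∀ X₀ : Matrix ι ι k, (∀ l, X₀ i₀ l = 0) → (∀ j, X₀ j i₀ = 0) →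
      P * X₀ * Q = C * Matrix.of (fun a b => X₀ (e a) (e b)) * R := by
    intro X₀ hr hc
    ext s t
    simp only [Matrix.mul_apply, Matrix.of_apply]
    rw [sum_eq_sum_equiv_ne i₀ e _ (by rw [hQ0, Finset.sum_eq_zero (fun j _ => by rw [hc, mul_zero]),
      zero_mul])]
    refine Finset.sum_congr rfl fun b _ => ?_
    rw [hQe, sum_eq_sum_equiv_ne i₀ e _ (by rw [hr, mul_zero])]
    refine congrArg (· * R b t) (Finset.sum_congr rfl fun a _ => ?_)
    rw [hPe]
  have hPΛQ : P * lamMatrix k i₀ * Q = C * R := by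
    have h1 : Matrix.of (fun a b => lamMatrix k i₀ (e a) (e b)) = 1 := by
      ext a b
      simp only [Matrix.of_apply, lamMatrix_apply, Matrix.one_apply, Subtype.coe_inj,
        EmbeddingLike.apply_eq_iff_eq, he, if_false]
    rw [hmul (lamMatrix k i₀) (fun l => by simp [lamMatrix_apply]) (fun j => by simp [lamMatrix_apply]),
      h1, Matrix.mul_one]
  -- reduce to the normal form `Λ_{i₀}`
  rw [← hPΛQ]
  constructor
  · intro h
    set X₀ : Matrix ι ι k := P⁻¹ * X * Q⁻¹ with hX₀
    have hX : X = P * X₀ * Q := by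
      rw [hX₀, show P * (P⁻¹ * X * Q⁻¹) * Q = P * P⁻¹ * X * (Q⁻¹ * Q) by
          simp only [Matrix.mul_assoc],
        Matrix.mul_nonsing_inv P hPd, Matrix.nonsing_inv_mul Q hQd, Matrix.one_mul, Matrix.mul_one]
    rw [hX, hessianMatrix_detPoly_mulVec_eq_zero_iff_of_mul_mul hPu hQu,
      hessianMatrix_detPoly_lamMatrix_mulVec_eq_zero_iff i₀ h2] at h
    obtain ⟨hr, hc, hs⟩ := h
    refine ⟨Matrix.of fun a b => X₀ (e a) (e b), ?_, ?_⟩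
    · have ht : ∑ j, X₀ j j = ∑ a, X₀ (e a) (e a) :=
        sum_eq_sum_equiv_ne i₀ e (fun j => X₀ j j) (hr i₀)
      rw [← Finset.add_sum_erase _ _ (Finset.mem_univ i₀), hr, zero_add, hs] at ht
      rw [Matrix.trace]
      simp only [Matrix.diag_apply, Matrix.of_apply]
      exact ht.symm
    · rw [hX]
      exact hmul X₀ hr hc
  · rintro ⟨Z, hZ, hXZ⟩
    let X₁ : Matrix ι ι k := Matrix.of fun j l =>
      if hj : j = i₀ then 0 else if hl : l = i₀ then 0 else Z (e.symm ⟨j, hj⟩) (e.symm ⟨l, hl⟩)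
    have hr : ∀ l, X₁ i₀ l = 0 := fun l => by simp [X₁]
    have hc : ∀ j, X₁ j i₀ = 0 := fun j => by
      simp only [X₁, Matrix.of_apply]
      split_ifs <;> rfl
    have hdiag : ∀ a b, X₁ (e a) (e b) = Z a b := fun a b => by
      simp only [X₁, Matrix.of_apply, he, dif_neg, not_false_eq_true, Subtype.coe_eta,
        Equiv.symm_apply_apply]
    have hZ' : Matrix.of (fun a b => X₁ (e a) (e b)) = Z := by
      ext a b
      rw [Matrix.of_apply, hdiag]
    have hX1 : X = P * X₁ * Q := by rw [hmul X₁ hr hc, hZ', hXZ]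
    rw [hX1, hessianMatrix_detPoly_mulVec_eq_zero_iff_of_mul_mul hPu hQu,
      hessianMatrix_detPoly_lamMatrix_mulVec_eq_zero_iff i₀ h2]
    refine ⟨hr, hc, ?_⟩
    have ht : ∑ j, X₁ j j = ∑ a, X₁ (e a) (e a) :=
      sum_eq_sum_equiv_ne i₀ e (fun j => X₁ j j) (hr i₀)
    rw [← Finset.add_sum_erase _ _ (Finset.mem_univ i₀), hr, zero_add] at ht
    rw [ht]
    simp_rw [hdiag]
    exact hZ

end Factorisation

end Literature.Computability.AlgebraicComplexity
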